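import Summits.BirchSwinnertonDyer.Rank1Residual.X4.KimDefectLevelLowering
import Summits.BirchSwinnertonDyer.Rank1Residual.Additive.KimStructureOfFiveLe
import HarnessLib

/-!
# Level lowering kills Kurihara numbers mod `p` — RANK ONE: under the certificate a Kurihara number
# non-zero modulo `p²` closes `Ш(E/ℚ)[p^∞] = 0` WITHOUT Cassels–Tate, and one non-zero modulo `p³`
# closes it WITH Cassels–Tate (class X4, analytic rank `1`, Tamagawa rows; cell `b2b-bsdres`,
# seat additive-p4 GEN 22, line V41; the rank-one companion of `X4/KimDefectLevelLowering.lean`)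

HONEST FRAMING (cell `b2b-bsdres`, run/shared/lean/b2b/bsd-rank1-residual/, verbatim in every
file): the goal of the cell is to DELETE the COMBINATION-SHAPED residual classes of the
Birch–Swinnerton-Dyer formula for ALL analytic-rank `≤ 1` elliptic curves over `ℚ` — "full BSD
formula for every rank `≤ 1` curve in class `C`" assembled STRICTLY from published theorems — so
that the rank-`≤ 1` remainder becomes exactly the CONSTRUCTION-SHAPED classes, which are TYPED
(missing-input `Prop`s), NOT attempted. This is not "finishing BSD". Seat additive-p4 (X3♯/X4♯
direct): research route on the CONSTRUCTION-SHAPED class X4; no claim beyond the stated classes; the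
X4 label and the §I O7 / N11 marks are UNCHANGED; NOTHING here is booked. THEOREMS ONLY (no
definition, no Literature fact, no `_holds`); every published input is an explicit named-fact
hypothesis; every certificate is an explicit hypothesis; `#print axioms` standard.

## What (and why it is not in `X4/KimDefectLevelLowering.lean` or in p17's files)

GEN 20 proved that the FINITE mod-`p` certificate `LevelLowering.PlusSymbolLevelLowersAt W p f ℓ₀`
(the plus symbol of `f_E` is, mod `p`, the `ℓ₀`-stabilised symbol of a `T_q`-eigen periodic function of
level `N/ℓ₀` — what `p ∣ c_{ℓ₀}` at a split multiplicative `ℓ₀ ∥ N` predicts by Ribet's level lowering)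
forces EVERY mod-`p` Kurihara number to vanish, so `∂^{(∞)}(δ̃) ≥ 1`
(`one_le_kuriharaPartialInfty_of_plusSymbolLevelLowersAt`), and drew the rank-`0` consequences. Team
n1011's p17 (`Additive/X4RankOneKimTamagawaDefect.lean`) proved the rank-`1` Tamagawa-row consumers
modulo the FULL `≥` half of Kim's Conjecture 1.10 (`X4.KimTamagawaDefectGeAt`, OPEN), and harvest-2
(`Additive/KimStructureOfFiveLe.lean`) discharged the rank-one `∂`-clause `KimRankOnePartialAt W p` at
`p ≥ 5` from Kim's clause (6) AS PRINTED (E73, flag `Kim2026-(6)-cyclic-reading`). THIS FILE puts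
the CERTIFICATE in place of the conjecture `hGe`:

* §1 (any `p`; the rank-one clause `hK : KimRankOnePartialAt W p` explicit): a lower bound
  `α ≤ ∂^{(∞)}` and ONE `δ̃_ℓ ≢ 0 (mod p^k)` at a cyclic Kolyvagin prime `ℓ ∈ 𝒫_k` give
  `ord_p #Ш(E/ℚ)(p) + α ≤ k − 1` (p17's proof with `ord_p ∏c` replaced by a free `α`); under the
  certificate (`α = 1`): **`k = 2` ⟹ `#Ш(E/ℚ)(p) = 1` with NO Cassels–Tate input**, and `BSD(E,p)` with
  the lane's `#Ш_an` a `p`-unit (GZK, modularity); **`k = 3` + Cassels–Tate ⟹ `ord_p #Ш = 0`**, `BSD(E,p)`.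
* §2 `p ≥ 5` (PUBLISHED inputs only — E73, the certificate, GZK, modularity, CT for `k = 3`): the
  same with `hK` DISCHARGED (`kimRankOnePartialAt_of_kim2026_of_five_le`); `ord_p #Ш(p) ≤ k − 2`.
* §3 `p = 3`, MODULO the cell's conjecture `X4SharpThreeKimRankOnePartial` (p17; printed reason Kim
  2025 Thm. 1.1 (Str), PREPRINT): the O7 ∩ X4@3 Tamagawa-row shapes with the certificate for `hGe`.

WHERE IT BITES (E2 anatomy; numbers of record; nothing booked): the O7 ∩ X4 Tamagawa rows — at
`p ≥ 5` the 470 open `r = 1`, `ord_p ∏c ≥ 1`, `p ∤ #Ш_an`, surjective cells of cc-eng-1's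
`class-closure/O7/pairs-openA-R203.tsv`; at `p = 3` the 7 903 'TAM' rows of p17's anatomy. Under the
certificate NO unit prime-level Kurihara number exists (`kuriharaNumber_eq_zero_of_plusSymbolLevelLowersAt`);
harvest-2's certificate-free level-two route (`RankOneTamagawaParity.lean`) needs Cassels–Tate and
reaches `ord_p ∏c = 1`; here level two is CT-free and level three (+ CT) reaches `ord_p ∏c = 2`. The
certificate is a per-pair FINITE computation (instrument `llcert.gp`, B-21; via the semistable twist
at level `N/p²` on the (G, e = 2) ∪ (M) cells); NOT a class theorem.

References: Kim 2026 [Kim2022StructureSelmer] Thm. 1.9 (6), §1.5.1, Conj. 1.10; Kim 2025 [Kim2025RefinedTNC]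
Thm. 1.1 (PREPRINT, reason only); Silverman AEC X.4.14 [SilvermanAEC2009]; Miller 2011 [Miller2011LMS]
Def. 1.1; Ribet 1990 [Ribet1990] Thm. 1.1 (why the certificate is expected; not an input).
-/

noncomputable section

open scoped Classical MatrixGroups ModularForm
open CongruenceSubgroup WeierstrassCurve Literature.NumberTheory.EllipticCurves
  Literature.NumberTheory.EllipticCurves.ModularForms
  Literature.NumberTheory.EllipticCurves.Rank1Residual
  Literature.NumberTheory.EllipticCurves.Rank1Residual.Typed
  Summit.BirchSwinnertonDyer.Rank1Residual.LevelLowering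
  Summit.BirchSwinnertonDyer.Rank1Residual.Additive

namespace Summit.BirchSwinnertonDyer.Rank1Residual.X4

variable (W : WeierstrassCurve ℚ) [W.IsElliptic] [W.IsGloballyMinimal] (p : ℕ) [Fact p.Prime]

/-! ## §1 Any `p`: the rank-one clause explicit, the certificate in place of Conjecture 1.10 -/

section AnyPrime

/-- **`ord_p #Ш(E/ℚ)(p) + α ≤ k − 1`** from the rank-one `∂`-clause `hK` (`length + ∂^{(∞)} = ∂^{(1)}`),
ANY lower bound `α ≤ ∂^{(∞)}(δ̃)` and ONE `δ̃_ℓ ≢ 0 (mod p^k)` at a cyclic Kolyvagin prime `ℓ ∈ 𝒫_k`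
(`∂^{(1)} ≤ k − 1`) — p17's Tamagawa-defect shape with a free `α`. ANY reduction at `p`; per pair.
[cite: Kim2022StructureSelmer, Thm. 1.9 (6) and §1.5.1 (PDF pp. 7–8)] -/
theorem padicValNat_primaryComponent_add_le_of_partial_of_le_partialInfty
    (hK : KimRankOnePartialAt W p)
    (hsurj : W.HasSurjectiveModNGaloisRep p)
    (htower : ∀ n : ℕ, W.HasSurjectiveModNGaloisRep (p ^ n : ℕ)) (hL : W.entireLFunction 1 = 0)
    (hr : W.analyticRank = 1) (hfin : Finite W.sha)
    {N : ℕ} [NeZero N] (D : ModularParametrizationData W N) (hc : ¬ (p : ℤ) ∣ D.maninConstant)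
    (hper : ∃ u : ℚ, ‖(u : ℚ_[p])‖ = 1 ∧ W.realPeriodRat = u * plusPeriod D.f)
    {α : ℕ} (hα : (α : ℕ∞) ≤ kuriharaPartialInfty W p D.f)
    {k : ℕ} (hk : 1 ≤ k) (ℓ : ℕ) [Fact ℓ.Prime] (hℓ : Kato.IsKolyvaginPrime W p k ℓ)
    (hcyc : Nat.card {P : ((WeierstrassCurve.integralModelInt W).map
        (Int.castRingHom (ZMod ℓ))).toAffine.Point // p • P = 0} ≤ p)
    (ψ : (ℓ' : ℕ) → (ZMod ℓ')ˣ →* Multiplicative (ZMod (p ^ k)))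
    (hψ : Function.Surjective (ψ ℓ)) (hδ : kuriharaNumber D.f (p ^ k) ℓ ψ ≠ 0) :
    padicValNat p (Nat.card (AddCommGroup.primaryComponent W.sha p)) + α ≤ k - 1 := by
  have h1 : kuriharaPartial W p D.f 1 ≤ ((k - 1 : ℕ) : ℕ∞) :=
    kuriharaPartial_one_le_of_kuriharaNumber_ne_zero W p D.f hk hℓ hcyc ψ hψ hδ
  have hne : kuriharaPartial W p D.f 1 ≠ ⊤ := ne_top_of_le_ne_top (ENat.coe_ne_top _) h1
  have hmain := hK hsurj htower hL hr hfin D hc hper hne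
  have h2 : (padicValNat p (Nat.card (AddCommGroup.primaryComponent W.sha p)) : ℕ∞) +
      (α : ℕ∞) ≤ ((k - 1 : ℕ) : ℕ∞) := by
    calc (padicValNat p (Nat.card (AddCommGroup.primaryComponent W.sha p)) : ℕ∞) + (α : ℕ∞)
        ≤ (padicValNat p (Nat.card (AddCommGroup.primaryComponent W.sha p)) : ℕ∞) +
            kuriharaPartialInfty W p D.f := add_le_add le_rfl hα
      _ = kuriharaPartial W p D.f 1 := hmain
      _ ≤ ((k - 1 : ℕ) : ℕ∞) := h1
  exact_mod_cast h2

/-- **Under the level-lowering certificate: `ord_p #Ш(E/ℚ)(p) + 1 ≤ k − 1`** (rank one, `hK`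
explicit): the certificate at some `ℓ₀ ∣ N_E` gives `1 ≤ ∂^{(∞)}(δ̃)` (`p` odd, `E[p]` irreducible from
`ρ̄` onto, `D` at the conductor level); then the previous theorem with `α = 1`. [cite: Kim2022StructureSelmer, Thm. 1.9 (6) (PDF p. 8)] -/
theorem padicValNat_primaryComponent_add_one_le_of_partial_of_plusSymbolLevelLowersAt
    (hK : KimRankOnePartialAt W p) (hp2 : p ≠ 2)
    (hsurj : W.HasSurjectiveModNGaloisRep p)
    (htower : ∀ n : ℕ, W.HasSurjectiveModNGaloisRep (p ^ n : ℕ)) (hL : W.entireLFunction 1 = 0)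
    (hr : W.analyticRank = 1) (hfin : Finite W.sha)
    {N : ℕ} [NeZero N] (D : ModularParametrizationData W N) (hN : W.conductorNorm ℤ = N)
    (hc : ¬ (p : ℤ) ∣ D.maninConstant)
    (hper : ∃ u : ℚ, ‖(u : ℚ_[p])‖ = 1 ∧ W.realPeriodRat = u * plusPeriod D.f)
    {ℓ₀ : ℕ} (hcert : PlusSymbolLevelLowersAt W p D.f ℓ₀) (hℓ₀ : ℓ₀ ∣ W.conductorNorm ℤ)
    {k : ℕ} (hk : 1 ≤ k) (ℓ : ℕ) [Fact ℓ.Prime] (hℓ : Kato.IsKolyvaginPrime W p k ℓ)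
    (hcyc : Nat.card {P : ((WeierstrassCurve.integralModelInt W).map
        (Int.castRingHom (ZMod ℓ))).toAffine.Point // p • P = 0} ≤ p)
    (ψ : (ℓ' : ℕ) → (ZMod ℓ')ˣ →* Multiplicative (ZMod (p ^ k)))
    (hψ : Function.Surjective (ψ ℓ)) (hδ : kuriharaNumber D.f (p ^ k) ℓ ψ ≠ 0) :
    padicValNat p (Nat.card (AddCommGroup.primaryComponent W.sha p)) + 1 ≤ k - 1 := by
  have hirr := hasIrreducibleModPGaloisRep_of_hasSurjectiveModNGaloisRep W p hsurj
  have h1 : ((1 : ℕ) : ℕ∞) ≤ kuriharaPartialInfty W p D.f := by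
    exact_mod_cast one_le_kuriharaPartialInfty_of_plusSymbolLevelLowersAt hp2 hirr D hN hcert hℓ₀
  exact padicValNat_primaryComponent_add_le_of_partial_of_le_partialInfty W p hK hsurj htower hL hr
    hfin D hc hper h1 hk ℓ hℓ hcyc ψ hψ hδ

/-- **Level TWO closes the row, Cassels–Tate-free**: under the certificate, ONE `δ̃_ℓ ≢ 0 (mod p²)`
at a cyclic `ℓ ∈ 𝒫_2` gives `#Ш(E/ℚ)(p) = 1`. Rank one, `hK` explicit; ANY reduction at `p`; per pair.
[cite: Kim2022StructureSelmer, Thm. 1.9 (6) and §1.5.1 (PDF pp. 7–8)] -/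
theorem card_primaryComponent_eq_one_of_partial_of_plusSymbolLevelLowersAt_levelTwo
    (hK : KimRankOnePartialAt W p) (hp2 : p ≠ 2)
    (hsurj : W.HasSurjectiveModNGaloisRep p)
    (htower : ∀ n : ℕ, W.HasSurjectiveModNGaloisRep (p ^ n : ℕ)) (hL : W.entireLFunction 1 = 0)
    (hr : W.analyticRank = 1) (hfin : Finite W.sha)
    {N : ℕ} [NeZero N] (D : ModularParametrizationData W N) (hN : W.conductorNorm ℤ = N)
    (hc : ¬ (p : ℤ) ∣ D.maninConstant)
    (hper : ∃ u : ℚ, ‖(u : ℚ_[p])‖ = 1 ∧ W.realPeriodRat = u * plusPeriod D.f)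
    {ℓ₀ : ℕ} (hcert : PlusSymbolLevelLowersAt W p D.f ℓ₀) (hℓ₀ : ℓ₀ ∣ W.conductorNorm ℤ)
    (ℓ : ℕ) [Fact ℓ.Prime] (hℓ : Kato.IsKolyvaginPrime W p 2 ℓ)
    (hcyc : Nat.card {P : ((WeierstrassCurve.integralModelInt W).map
        (Int.castRingHom (ZMod ℓ))).toAffine.Point // p • P = 0} ≤ p)
    (ψ : (ℓ' : ℕ) → (ZMod ℓ')ˣ →* Multiplicative (ZMod (p ^ 2)))
    (hψ : Function.Surjective (ψ ℓ)) (hδ : kuriharaNumber D.f (p ^ 2) ℓ ψ ≠ 0) :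
    Nat.card (AddCommGroup.primaryComponent W.sha p) = 1 := by
  haveI : Finite W.sha := hfin
  have h := padicValNat_primaryComponent_add_one_le_of_partial_of_plusSymbolLevelLowersAt W p hK hp2
    hsurj htower hL hr hfin D hN hc hper hcert hℓ₀ (by norm_num) ℓ hℓ hcyc ψ hψ hδ
  exact card_primaryComponent_eq_one_of_padicValNat_eq_zero W p (by omega)

/-- **`BSD(E,p)` on a rank-one Tamagawa row from the certificate + ONE Kurihara number mod `p²`**,
Cassels–Tate-free: `#Ш(E/ℚ)(p) = 1`, the lane's `#Ш_an = q` with `ord_p q = 0`, GZK, modularity.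
Rank one, `hK` explicit; per pair; nothing booked. [cite: Kim2022StructureSelmer, Thm. 1.9 (6) (PDF p. 8)]
[cite: Miller2011LMS, Def. 1.1] -/
theorem bsdp_of_partial_of_plusSymbolLevelLowersAt_levelTwo_of_shaAn_unit
    (hK : KimRankOnePartialAt W p) (hp2 : p ≠ 2)
    (hGZK : rank_eq_analyticRank_of_analyticRank_le_one) (hmod : hasEntireLFunction_rat)
    (hsurj : W.HasSurjectiveModNGaloisRep p)
    (htower : ∀ n : ℕ, W.HasSurjectiveModNGaloisRep (p ^ n : ℕ)) (hr : W.analyticRank = 1)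
    {N : ℕ} [NeZero N] (D : ModularParametrizationData W N) (hN : W.conductorNorm ℤ = N)
    (hc : ¬ (p : ℤ) ∣ D.maninConstant)
    (hper : ∃ u : ℚ, ‖(u : ℚ_[p])‖ = 1 ∧ W.realPeriodRat = u * plusPeriod D.f)
    {ℓ₀ : ℕ} (hcert : PlusSymbolLevelLowersAt W p D.f ℓ₀) (hℓ₀ : ℓ₀ ∣ W.conductorNorm ℤ)
    (ℓ : ℕ) [Fact ℓ.Prime] (hℓ : Kato.IsKolyvaginPrime W p 2 ℓ)
    (hcyc : Nat.card {P : ((WeierstrassCurve.integralModelInt W).map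
        (Int.castRingHom (ZMod ℓ))).toAffine.Point // p • P = 0} ≤ p)
    (ψ : (ℓ' : ℕ) → (ZMod ℓ')ˣ →* Multiplicative (ZMod (p ^ 2)))
    (hψ : Function.Surjective (ψ ℓ)) (hδ : kuriharaNumber D.f (p ^ 2) ℓ ψ ≠ 0)
    {q : ℚ} (hq : shaAn W = (q : ℂ)) (hv : padicValRat p q = 0) : BSDp W p := by
  have hL : W.entireLFunction 1 = 0 := by
    by_contra hne
    have h0 := (W.analyticRank_eq_zero_iff_holds (hmod W)).mpr hne
    omega
  obtain ⟨hmw, hfin⟩ := hGZK W (by rw [hr])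
  have hcard := card_primaryComponent_eq_one_of_partial_of_plusSymbolLevelLowersAt_levelTwo W p hK
    hp2 hsurj htower hL hr hfin D hN hc hper hcert hℓ₀ ℓ hℓ hcyc ψ hψ hδ
  exact (bsdp_iff_padicValRat_eq_zero_of_card_primaryComponent_eq_one W p hmw hfin hcard hq).mpr hv

/-- **Level THREE + Cassels–Tate**: under the certificate, ONE `δ̃_ℓ ≢ 0 (mod p³)` at a cyclic
`ℓ ∈ 𝒫_3` gives `ord_p #Ш(p) ≤ 1`, and the squareness of `#Ш` (`hCT`) forces `ord_p #Ш = 0` — the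
shape for the `ord_p ∏c_ℓ = 2` rows (Conj. 1.10 predicts `∂^{(1)} = ∂^{(∞)} = 2` there). Rank one,
`hK` explicit; per pair. [cite: Kim2022StructureSelmer, Thm. 1.9 (6) and Conj. 1.10 (PDF p. 8)] [cite: SilvermanAEC2009, Thm. X.4.14] -/
theorem padicValNat_shaOrder_eq_zero_of_partial_of_plusSymbolLevelLowersAt_levelThree_of_casselsTate
    (hK : KimRankOnePartialAt W p) (hp2 : p ≠ 2) (hCT : exists_casselsTate_pairing (K := ℚ))
    (hGZK : rank_eq_analyticRank_of_analyticRank_le_one) (hmod : hasEntireLFunction_rat)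
    (hsurj : W.HasSurjectiveModNGaloisRep p)
    (htower : ∀ n : ℕ, W.HasSurjectiveModNGaloisRep (p ^ n : ℕ)) (hr : W.analyticRank = 1)
    {N : ℕ} [NeZero N] (D : ModularParametrizationData W N) (hN : W.conductorNorm ℤ = N)
    (hc : ¬ (p : ℤ) ∣ D.maninConstant)
    (hper : ∃ u : ℚ, ‖(u : ℚ_[p])‖ = 1 ∧ W.realPeriodRat = u * plusPeriod D.f)
    {ℓ₀ : ℕ} (hcert : PlusSymbolLevelLowersAt W p D.f ℓ₀) (hℓ₀ : ℓ₀ ∣ W.conductorNorm ℤ)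
    (ℓ : ℕ) [Fact ℓ.Prime] (hℓ : Kato.IsKolyvaginPrime W p 3 ℓ)
    (hcyc : Nat.card {P : ((WeierstrassCurve.integralModelInt W).map
        (Int.castRingHom (ZMod ℓ))).toAffine.Point // p • P = 0} ≤ p)
    (ψ : (ℓ' : ℕ) → (ZMod ℓ')ˣ →* Multiplicative (ZMod (p ^ 3)))
    (hψ : Function.Surjective (ψ ℓ)) (hδ : kuriharaNumber D.f (p ^ 3) ℓ ψ ≠ 0) :
    padicValNat p W.shaOrder = 0 := by
  have hr1 : W.analyticRank ≤ 1 := by rw [hr]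
  have hL : W.entireLFunction 1 = 0 := by
    by_contra hne
    have h0 := (W.analyticRank_eq_zero_iff_holds (hmod W)).mpr hne
    omega
  have hfin : W.ShaFinite := (hGZK W hr1).2
  haveI : Finite W.sha := hfin
  have h := padicValNat_primaryComponent_add_one_le_of_partial_of_plusSymbolLevelLowersAt W p hK hp2
    hsurj htower hL hr hfin D hN hc hper hcert hℓ₀ (by norm_num) ℓ hℓ hcyc ψ hψ hδ
  have hle : padicValNat p (Nat.card (AddCommGroup.primaryComponent W.sha p)) ≤ 1 := by omega
  rw [padicValNat_card_addPrimaryComponent p] at hle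
  have hsq : IsSquare W.shaOrder := isSquare_shaOrder_of_casselsTate hCT W hfin
  have hn : W.shaOrder ≠ 0 := (WeierstrassCurve.shaOrder_pos W hfin).ne'
  by_contra h0
  have hdvd : p ∣ W.shaOrder := by
    by_contra hnd
    exact h0 (padicValNat.eq_zero_of_not_dvd hnd)
  have h2 : 2 ≤ padicValNat p W.shaOrder := two_le_padicValNat_of_isSquare_of_dvd hsq hn hdvd
  have : padicValNat p W.shaOrder ≤ 1 := by
    unfold WeierstrassCurve.shaOrder; exact hle
  omega

/-- **`BSD(E,p)` at level THREE + Cassels–Tate** on a rank-one row with `#Ш_an = q`, `ord_p q = 0`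
(`Typed.bsdp_of_shaAn_unit_of_noPTorsion`, GZK). Rank one, `hK` explicit; per pair; nothing booked.
[cite: Kim2022StructureSelmer, Thm. 1.9 (6) (PDF p. 8)] [cite: SilvermanAEC2009, Thm. X.4.14] [cite: Miller2011LMS, Def. 1.1] -/
theorem bsdp_of_partial_of_plusSymbolLevelLowersAt_levelThree_of_casselsTate_of_shaAn_unit
    (hK : KimRankOnePartialAt W p) (hp2 : p ≠ 2) (hCT : exists_casselsTate_pairing (K := ℚ))
    (hGZK : rank_eq_analyticRank_of_analyticRank_le_one) (hmod : hasEntireLFunction_rat)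
    (hsurj : W.HasSurjectiveModNGaloisRep p)
    (htower : ∀ n : ℕ, W.HasSurjectiveModNGaloisRep (p ^ n : ℕ)) (hr : W.analyticRank = 1)
    {N : ℕ} [NeZero N] (D : ModularParametrizationData W N) (hN : W.conductorNorm ℤ = N)
    (hc : ¬ (p : ℤ) ∣ D.maninConstant)
    (hper : ∃ u : ℚ, ‖(u : ℚ_[p])‖ = 1 ∧ W.realPeriodRat = u * plusPeriod D.f)
    {ℓ₀ : ℕ} (hcert : PlusSymbolLevelLowersAt W p D.f ℓ₀) (hℓ₀ : ℓ₀ ∣ W.conductorNorm ℤ)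
    (ℓ : ℕ) [Fact ℓ.Prime] (hℓ : Kato.IsKolyvaginPrime W p 3 ℓ)
    (hcyc : Nat.card {P : ((WeierstrassCurve.integralModelInt W).map
        (Int.castRingHom (ZMod ℓ))).toAffine.Point // p • P = 0} ≤ p)
    (ψ : (ℓ' : ℕ) → (ZMod ℓ')ˣ →* Multiplicative (ZMod (p ^ 3)))
    (hψ : Function.Surjective (ψ ℓ)) (hδ : kuriharaNumber D.f (p ^ 3) ℓ ψ ≠ 0)
    {q : ℚ} (hq : shaAn W = (q : ℂ)) (hv : padicValRat p q = 0) : BSDp W p := by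
  have hr1 : W.analyticRank ≤ 1 := by rw [hr]
  have hfin : W.ShaFinite := (hGZK W hr1).2
  have h0 := padicValNat_shaOrder_eq_zero_of_partial_of_plusSymbolLevelLowersAt_levelThree_of_casselsTate
    W p hK hp2 hCT hGZK hmod hsurj htower hr D hN hc hper hcert hℓ₀ ℓ hℓ hcyc ψ hψ hδ
  have hn : W.shaOrder ≠ 0 := (WeierstrassCurve.shaOrder_pos W hfin).ne'
  have hnd : ¬ p ∣ W.shaOrder := by
    intro hdvd
    have := (padicValNat_dvd_iff_le hn).1 (by simpa using hdvd : p ^ 1 ∣ W.shaOrder)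
    omega
  refine bsdp_of_shaAn_unit_of_noPTorsion W p hGZK hr1 hq hv ?_
  intro x hx
  by_contra hx0
  refine hnd (dvd_shaOrder_of_exists_torsion W p ⟨x, hx0, ?_⟩)
  rw [← natCast_zsmul]
  exact hx

end AnyPrime

/-! ## §2 `p ≥ 5`: the rank-one clause DISCHARGED by Kim's theorem (E73) — published inputs only -/

section FiveLe

/-- **`p ≥ 5`, level TWO, Cassels–Tate-free, PUBLISHED inputs + the certificate**: E73 (`hE73`),
`ρ̄_{E,p}` + tower onto, `r_an = 1`, conductor-level datum `D` with `p ∤ c_D` + period transfer, the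
certificate at `ℓ₀ ∣ N_E`, ONE `δ̃_ℓ ≢ 0 (mod p²)` at a cyclic `ℓ ∈ 𝒫_2`, `#Ш_an` a `p`-unit ⟹
`BSD(E,p)`. ANY reduction at `p`; per pair; nothing booked. [cite: Kim2022StructureSelmer, Thm. 1.9 (6) (PDF p. 8)]
[cite: Miller2011LMS, Def. 1.1] -/
theorem bsdp_of_plusSymbolLevelLowersAt_levelTwo_rankOne_of_shaAn_unit_of_five_le
    (hE73 : Kim2026.kuriharaPartial_vanishingOrder_eq_padicValNat_sha_add_partialInfty_of_maninConstant)
    (hGZK : rank_eq_analyticRank_of_analyticRank_le_one) (hmod : hasEntireLFunction_rat)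
    (hp : 5 ≤ p) (hsurj : W.HasSurjectiveModNGaloisRep p)
    (htower : ∀ n : ℕ, W.HasSurjectiveModNGaloisRep (p ^ n : ℕ)) (hr : W.analyticRank = 1)
    {N : ℕ} [NeZero N] (D : ModularParametrizationData W N) (hN : W.conductorNorm ℤ = N)
    (hc : ¬ (p : ℤ) ∣ D.maninConstant)
    (hper : ∃ u : ℚ, ‖(u : ℚ_[p])‖ = 1 ∧ W.realPeriodRat = u * plusPeriod D.f)
    {ℓ₀ : ℕ} (hcert : PlusSymbolLevelLowersAt W p D.f ℓ₀) (hℓ₀ : ℓ₀ ∣ W.conductorNorm ℤ)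
    (ℓ : ℕ) [Fact ℓ.Prime] (hℓ : Kato.IsKolyvaginPrime W p 2 ℓ)
    (hcyc : Nat.card {P : ((WeierstrassCurve.integralModelInt W).map
        (Int.castRingHom (ZMod ℓ))).toAffine.Point // p • P = 0} ≤ p)
    (ψ : (ℓ' : ℕ) → (ZMod ℓ')ˣ →* Multiplicative (ZMod (p ^ 2)))
    (hψ : Function.Surjective (ψ ℓ)) (hδ : kuriharaNumber D.f (p ^ 2) ℓ ψ ≠ 0)
    {q : ℚ} (hq : shaAn W = (q : ℂ)) (hv : padicValRat p q = 0) : BSDp W p :=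
  bsdp_of_partial_of_plusSymbolLevelLowersAt_levelTwo_of_shaAn_unit W p
    (kimRankOnePartialAt_of_kim2026_of_five_le W p hE73 hp) (by omega) hGZK hmod hsurj htower hr D hN
    hc hper hcert hℓ₀ ℓ hℓ hcyc ψ hψ hδ hq hv

/-- **`p ≥ 5`, level THREE + Cassels–Tate, PUBLISHED inputs + the certificate** (`ord_p ∏c = 2`
rows): E73, CT, GZK, modularity, the certificate, ONE `δ̃_ℓ ≢ 0 (mod p³)` at a cyclic `ℓ ∈ 𝒫_3`,
`#Ш_an` a `p`-unit ⟹ `BSD(E,p)`. Per pair; nothing booked. [cite: Kim2022StructureSelmer, Thm. 1.9 (6) (PDF p. 8)]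
[cite: SilvermanAEC2009, Thm. X.4.14] [cite: Miller2011LMS, Def. 1.1] -/
theorem bsdp_of_plusSymbolLevelLowersAt_levelThree_rankOne_of_casselsTate_of_shaAn_unit_of_five_le
    (hE73 : Kim2026.kuriharaPartial_vanishingOrder_eq_padicValNat_sha_add_partialInfty_of_maninConstant)
    (hCT : exists_casselsTate_pairing (K := ℚ))
    (hGZK : rank_eq_analyticRank_of_analyticRank_le_one) (hmod : hasEntireLFunction_rat)
    (hp : 5 ≤ p) (hsurj : W.HasSurjectiveModNGaloisRep p)
    (htower : ∀ n : ℕ, W.HasSurjectiveModNGaloisRep (p ^ n : ℕ)) (hr : W.analyticRank = 1)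
    {N : ℕ} [NeZero N] (D : ModularParametrizationData W N) (hN : W.conductorNorm ℤ = N)
    (hc : ¬ (p : ℤ) ∣ D.maninConstant)
    (hper : ∃ u : ℚ, ‖(u : ℚ_[p])‖ = 1 ∧ W.realPeriodRat = u * plusPeriod D.f)
    {ℓ₀ : ℕ} (hcert : PlusSymbolLevelLowersAt W p D.f ℓ₀) (hℓ₀ : ℓ₀ ∣ W.conductorNorm ℤ)
    (ℓ : ℕ) [Fact ℓ.Prime] (hℓ : Kato.IsKolyvaginPrime W p 3 ℓ)
    (hcyc : Nat.card {P : ((WeierstrassCurve.integralModelInt W).map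
        (Int.castRingHom (ZMod ℓ))).toAffine.Point // p • P = 0} ≤ p)
    (ψ : (ℓ' : ℕ) → (ZMod ℓ')ˣ →* Multiplicative (ZMod (p ^ 3)))
    (hψ : Function.Surjective (ψ ℓ)) (hδ : kuriharaNumber D.f (p ^ 3) ℓ ψ ≠ 0)
    {q : ℚ} (hq : shaAn W = (q : ℂ)) (hv : padicValRat p q = 0) : BSDp W p :=
  bsdp_of_partial_of_plusSymbolLevelLowersAt_levelThree_of_casselsTate_of_shaAn_unit W p
    (kimRankOnePartialAt_of_kim2026_of_five_le W p hE73 hp) (by omega) hCT hGZK hmod hsurj htower hr D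
    hN hc hper hcert hℓ₀ ℓ hℓ hcyc ψ hψ hδ hq hv

/-- **`p ≥ 5`, the general level** (PUBLISHED inputs + certificates): E73, the level-lowering
certificate and ONE `δ̃_ℓ ≢ 0 (mod p^k)` at a cyclic `ℓ ∈ 𝒫_k` give `ord_p #Ш(E/ℚ)(p) ≤ k − 2` —
one better than the certificate-free `ord_p #Ш(p) ≤ k − 1` of
`Kim2026.padicValNat_sha_le_kuriharaPartial_one`. ANY reduction at `p`; per pair.
[cite: Kim2022StructureSelmer, Thm. 1.9 (6) and §1.5.1 (PDF pp. 7–8)] -/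
theorem padicValNat_primaryComponent_le_sub_two_of_plusSymbolLevelLowersAt_rankOne_of_five_le
    (hE73 : Kim2026.kuriharaPartial_vanishingOrder_eq_padicValNat_sha_add_partialInfty_of_maninConstant)
    (hp : 5 ≤ p) (hsurj : W.HasSurjectiveModNGaloisRep p)
    (htower : ∀ n : ℕ, W.HasSurjectiveModNGaloisRep (p ^ n : ℕ)) (hL : W.entireLFunction 1 = 0)
    (hr : W.analyticRank = 1) (hfin : Finite W.sha)
    {N : ℕ} [NeZero N] (D : ModularParametrizationData W N) (hN : W.conductorNorm ℤ = N)
    (hc : ¬ (p : ℤ) ∣ D.maninConstant)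
    (hper : ∃ u : ℚ, ‖(u : ℚ_[p])‖ = 1 ∧ W.realPeriodRat = u * plusPeriod D.f)
    {ℓ₀ : ℕ} (hcert : PlusSymbolLevelLowersAt W p D.f ℓ₀) (hℓ₀ : ℓ₀ ∣ W.conductorNorm ℤ)
    {k : ℕ} (hk : 1 ≤ k) (ℓ : ℕ) [Fact ℓ.Prime] (hℓ : Kato.IsKolyvaginPrime W p k ℓ)
    (hcyc : Nat.card {P : ((WeierstrassCurve.integralModelInt W).map
        (Int.castRingHom (ZMod ℓ))).toAffine.Point // p • P = 0} ≤ p)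
    (ψ : (ℓ' : ℕ) → (ZMod ℓ')ˣ →* Multiplicative (ZMod (p ^ k)))
    (hψ : Function.Surjective (ψ ℓ)) (hδ : kuriharaNumber D.f (p ^ k) ℓ ψ ≠ 0) :
    padicValNat p (Nat.card (AddCommGroup.primaryComponent W.sha p)) ≤ k - 2 := by
  have h := padicValNat_primaryComponent_add_one_le_of_partial_of_plusSymbolLevelLowersAt W p
    (kimRankOnePartialAt_of_kim2026_of_five_le W p hE73 hp) (by omega) hsurj htower hL hr hfin D hN
    hc hper hcert hℓ₀ hk ℓ hℓ hcyc ψ hψ hδ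
  omega

end FiveLe

/-! ## §3 `p = 3` (O7 ∩ X4@3 Tamagawa rows), MODULO the cell's conjecture `X4SharpThreeKimRankOnePartial` -/

section Three

variable (W : WeierstrassCurve ℚ) [W.IsElliptic] [W.IsGloballyMinimal]

/-- **O7 ∩ X4@3, Tamagawa row, certificate + level TWO, Cassels–Tate-free, MODULO the conjecture**
`X4SharpThreeKimRankOnePartial` (`h3`, p17; printed reason Kim 2025 Thm. 1.1 (Str), PREPRINT): on
`ClassX4 W 3` ∧ `r_an = 1` with surj(3) and a tower certificate, a conductor-level datum `D` with
`3 ∤ c_D` and period transfer, the mod-`3` level-lowering certificate at some `ℓ₀ ∣ N_E`, ONE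
`δ̃_ℓ ≢ 0 (mod 9)` at a cyclic `ℓ ∈ 𝒫_2(E,3)` and `#Ш_an = q` a `3`-unit: `BSD(E,3)`. Per pair; NOT a
class theorem; nothing booked. [cite: Kim2022StructureSelmer, Thm. 1.9 (6) (PDF p. 8)]
[cite: Kim2025RefinedTNC, Thm. 1.1 (Str) (PDF p. 4; ANNOUNCED preprint — the reason, not a source of truth)]
[cite: Miller2011LMS, Def. 1.1] -/
theorem X4RankOne.bsdp_three_of_partial_of_plusSymbolLevelLowersAt_levelTwo
    (h3 : X4SharpThreeKimRankOnePartial)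
    (hGZK : rank_eq_analyticRank_of_analyticRank_le_one) (hmod : hasEntireLFunction_rat)
    (hX : ClassX4 W 3) (hsurj : W.HasSurjectiveModNGaloisRep 3)
    (htower : ∀ n : ℕ, W.HasSurjectiveModNGaloisRep (3 ^ n : ℕ)) (hr : W.analyticRank = 1)
    {N : ℕ} [NeZero N] (D : ModularParametrizationData W N) (hN : W.conductorNorm ℤ = N)
    (hc : ¬ (3 : ℤ) ∣ D.maninConstant)
    (hper : ∃ u : ℚ, ‖(u : ℚ_[3])‖ = 1 ∧ W.realPeriodRat = u * plusPeriod D.f)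
    {ℓ₀ : ℕ} (hcert : PlusSymbolLevelLowersAt W 3 D.f ℓ₀) (hℓ₀ : ℓ₀ ∣ W.conductorNorm ℤ)
    (ℓ : ℕ) [Fact ℓ.Prime] (hℓ : Kato.IsKolyvaginPrime W 3 2 ℓ)
    (hcyc : Nat.card {P : ((WeierstrassCurve.integralModelInt W).map
        (Int.castRingHom (ZMod ℓ))).toAffine.Point // 3 • P = 0} ≤ 3)
    (ψ : (ℓ' : ℕ) → (ZMod ℓ')ˣ →* Multiplicative (ZMod (3 ^ 2)))
    (hψ : Function.Surjective (ψ ℓ)) (hδ : kuriharaNumber D.f (3 ^ 2) ℓ ψ ≠ 0)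
    {q : ℚ} (hq : shaAn W = (q : ℂ)) (hv : padicValRat 3 q = 0) : BSDp W 3 :=
  bsdp_of_partial_of_plusSymbolLevelLowersAt_levelTwo_of_shaAn_unit W 3
    (kimRankOnePartialAt_three_of_classX4 W h3 hX) (by norm_num) hGZK hmod hsurj htower hr D hN hc
    hper hcert hℓ₀ ℓ hℓ hcyc ψ hψ hδ hq hv

/-- **O7 ∩ X4@3, certificate + level THREE + Cassels–Tate, MODULO the conjecture** (`ord₃ ∏c = 2`
rows): ONE `δ̃_ℓ ≢ 0 (mod 27)` at a cyclic `ℓ ∈ 𝒫_3(E,3)` and `hCT`. Per pair; nothing booked.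
[cite: Kim2025RefinedTNC, Thm. 1.1 (Str) (PDF p. 4; ANNOUNCED preprint — the reason, not a source of truth)]
[cite: Kim2022StructureSelmer, Thm. 1.9 (6) (PDF p. 8)] [cite: SilvermanAEC2009, Thm. X.4.14] -/
theorem X4RankOne.bsdp_three_of_partial_of_plusSymbolLevelLowersAt_levelThree_of_casselsTate
    (h3 : X4SharpThreeKimRankOnePartial) (hCT : exists_casselsTate_pairing (K := ℚ))
    (hGZK : rank_eq_analyticRank_of_analyticRank_le_one) (hmod : hasEntireLFunction_rat)
    (hX : ClassX4 W 3) (hsurj : W.HasSurjectiveModNGaloisRep 3)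
    (htower : ∀ n : ℕ, W.HasSurjectiveModNGaloisRep (3 ^ n : ℕ)) (hr : W.analyticRank = 1)
    {N : ℕ} [NeZero N] (D : ModularParametrizationData W N) (hN : W.conductorNorm ℤ = N)
    (hc : ¬ (3 : ℤ) ∣ D.maninConstant)
    (hper : ∃ u : ℚ, ‖(u : ℚ_[3])‖ = 1 ∧ W.realPeriodRat = u * plusPeriod D.f)
    {ℓ₀ : ℕ} (hcert : PlusSymbolLevelLowersAt W 3 D.f ℓ₀) (hℓ₀ : ℓ₀ ∣ W.conductorNorm ℤ)
    (ℓ : ℕ) [Fact ℓ.Prime] (hℓ : Kato.IsKolyvaginPrime W 3 3 ℓ)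
    (hcyc : Nat.card {P : ((WeierstrassCurve.integralModelInt W).map
        (Int.castRingHom (ZMod ℓ))).toAffine.Point // 3 • P = 0} ≤ 3)
    (ψ : (ℓ' : ℕ) → (ZMod ℓ')ˣ →* Multiplicative (ZMod (3 ^ 3)))
    (hψ : Function.Surjective (ψ ℓ)) (hδ : kuriharaNumber D.f (3 ^ 3) ℓ ψ ≠ 0)
    {q : ℚ} (hq : shaAn W = (q : ℂ)) (hv : padicValRat 3 q = 0) : BSDp W 3 :=
  bsdp_of_partial_of_plusSymbolLevelLowersAt_levelThree_of_casselsTate_of_shaAn_unit W 3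
    (kimRankOnePartialAt_three_of_classX4 W h3 hX) (by norm_num) hCT hGZK hmod hsurj htower hr D hN
    hc hper hcert hℓ₀ ℓ hℓ hcyc ψ hψ hδ hq hv

end Three

end Summit.BirchSwinnertonDyer.Rank1Residual.X4

end
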